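import Literature.IUT.HodgeArakelov.LabelClassesOfCuspsSeparationTransport
import Literature.AnabelianGeometry.SemiGraphs.TemperedDecompositionOfGalSect
import HarnessLib

/-!
# [IUTchII] Def 2.3 (v) at the tower of record, conditional BY NAME on the FACT-LIST row [GalSect] Thm 1.3 (ii) (`GalSect.Thm_1_3_ii_cusps`)

S. Mochizuki, *Inter-universal Teichmüller theory II*, kurims manuscript (Dec. 2020), §2 Def 2.3 (iii) p. 68, (v) p. 69
[claim: Mochizuki2012, status: disputed] (IUTchII §2 Def 2.3 (v), kurims p.69) (D-0012 claim key; record-only); S. Mochizuki, *Galois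
sections in absolute anabelian geometry* [GalSect] = [Mzk8], Thm 1.3 (ii) p. 6 («`D_x` is commensurably terminal in `Π_{X_K}`.  If `x` is a
cusp, then `D_x = C_{Π_{X_K}}(H)` for any open subgroup `H ⊆ I_x`») [cite: MochizukiGalSect2005, Thm 1.3 (ii) p.6].

abc-iut cell, seat abc-iut-w5-d132 (gen 6), row «DEF23V-SEP-CURRENCY» part 2: the LAST currency conversion of the cusp-separation residual
of «`|LabCusp^±(Π̂^±_v)| = l`» (p449023) / «`Nonempty (FlTorsorStructureConj CuHat)`» (p450102).  PROOF-ONLY (no `def`, no instance, no new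
named fact).  `LabelClassesOfCuspsSeparationTransport` (p450846) took the residual in abc-iut-f-174's binder shape `h13ii′` on the curve's own
completion `Π_{X_K} = M.PiHat`; abc-iut-f-174's `TemperedCurve.commensurator_eq_map_toHat_of_galSect_cusps` (`TemperedDecompositionOfGalSect`)
produces exactly that binder FROM THE TYPED FACT `AbsoluteAnabelian.GalSect.Thm_1_3_ii_cusps C` (FACT-LIST **F-0103**, admissible at named
instances) at an L4 datum `(E, C)` DICTIONARY-IDENTIFIED with the completion of `X` (`j : Π_{X_K} → E.arith` injective with the same
augmentation kernel; `C.Dcusp (κ x) = j(toHat D_x)`).  Composing: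

* **`card_labCuspPM_ofPiCHat_eq_l_of_galSect`** — `Nat.card (LabCuspPM CuHat W.pmHat W.pmHat) = l` at the tower of record, for every cuspidal
  datum with the p432649 characterisation, CONDITIONAL BY NAME on `GalSect.Thm_1_3_ii_cusps C` (+ the dictionary, F-1674, `op`, «unique
  cusp», L02 `hZ`, `hN`);
* **`nonempty_flTorsorStructureConj_ofPiCHat_of_galSect`** — the Def 2.3 (v) successor structure EXISTS at the tower of record, conditional BY
  NAME on `GalSect.Thm_1_3_ii_cusps C` and on the (R1c) binder `hR1c` («the inversion reverses `Z`», GAP-LEDGER D-G-w4d010-2h) (+ the same).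

HONEST LABEL: [GalSect] Thm 1.3 (ii) is CONSUMED as the tree's named predicate at a dictionary-identified datum (the dictionary is a
hypothesis, not a construction), never proved; nothing of the series is asserted; no side taken on [IUTchIII] Cor 3.12; typed ≠ proved.
-/

noncomputable section

namespace Literature.IUT.HodgeArakelov

open Literature.AnabelianGeometry Literature.AnabelianGeometry.EtaleTheta Literature.AnabelianGeometry.SemiGraphs
open Literature.AnabelianGeometry.AbsoluteAnabelian
open scoped Pointwise

namespace PlusMinusTower

universe u

variable {p : ℕ} [Fact p.Prime] {M : MuTwoSetting p} (e : M.CLevelData)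
  {E : M.toThetaSetting.EtaleThetaData} {l : ℕ} (C : E.DoubleUnderline l) {N : ℕ+}
  (μ : M.toThetaSetting.CyclotomeMod l N) (hC : M.toThetaSetting.Compat) (hS : M.toThetaSetting.Sec2Hyps)
  (hl : l.Prime) (hp2 : p ≠ 2) (hpl : p ≠ l) (hζ : ∃ ζ : M.toThetaSetting.K, IsPrimitiveRoot ζ (4 * l))
  {η : (C.thetaEnvData μ hC hS).PiYdd → MuN p N} (hη : η ∈ (C.thetaEnvData μ hC hS).thetaCocycles)
  (hZ : Thm16Sub.KerToZIsCompactlyGenerated M.toThetaSetting) (hN : (C.Huu.subgroupOf (M.GtpXu l)).Normal)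
  {P : TopGroup.{0}} (T : TemperedCoverings (BadPlaceSetting.ofUnderline C μ hC hS hl hp2 hpl hζ hη) P) {x₀ : M.Pt}
  {EX : FundamentalExtension.{u}} (j : M.PiHat →ₜ* EX.arith) (hj : Function.Injective j)
  (haug : ∀ y : M.PiHat, EX.aug (j y) = 1 ↔ M.augHat y = 1) (CX : EX.CuspidalData) (κ : ∀ x : M.Pt, M.IsCusp x → CX.Cusp)
  (hκ : ∀ (x : M.Pt) (hx : M.IsCusp x), CX.Dcusp (κ x hx) = ((M.decomp x).map M.toHat.toMonoidHom).map j.toMonoidHom)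

include hj haug hκ in
/-- **`|LabCusp^±(Π̂^±_v)| = l` at the tower of record, CONDITIONAL BY NAME on [GalSect] Thm 1.3 (ii)** (FACT-LIST F-0103
`GalSect.Thm_1_3_ii_cusps` at an L4 datum dictionary-identified with `Π_{X_K}`), for every cuspidal datum with the p432649 characterisation;
further inputs F-1674, `op`, «unique cusp», L02 `hZ`, `hN`. [claim: Mochizuki2012, status: disputed] (IUTchII §2 Def 2.3 (iii)/(v), kurims pp.68–69) -/
theorem card_labCuspPM_ofPiCHat_eq_l_of_galSect (hGS : GalSect.Thm_1_3_ii_cusps CX)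
    (op : M.toThetaSetting.OncePuncturedData) (hx₀ : M.IsCusp x₀)
    (huniq : ∀ x' : M.Pt, M.IsCusp x' → x' = x₀) (h65iii : M.toTemperedCurve.IsoPreservesCuspidalDecomp M.toTemperedCurve)
    (CuHat : CuspidalInertiaData (ofPiCHat e C μ hC hS hl hp2 hpl hζ hη hZ hN T))
    (hCu : ∀ Q' J : Subgroup (ofPiCHat e C μ hC hS hl hp2 hpl hζ hη hZ hN T).Corhat,
      CuHat.IsCuspidalInertia Q' J ↔ J ≤ Q' ∧ ∃ i : {x : M.Pt // M.IsCusp x} × M.GtpC,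
        ∃ γ ∈ (ofPiCHat e C μ hC hS hl hp2 hpl hζ hη hZ hN T).pmHat,
          J = MulAut.conj γ •
            ((((MulAut.conj i.2 • (M.toTemperedCurve.inertia i.1.1).map M.inclX) ⊓ (M.GtpXu l).map M.inclX).map
              e.toPiCHat.toMonoidHom : Subgroup (ofPiCHat e C μ hC hS hl hp2 hpl hζ hη hZ hN T).Corhat)).topologicalClosure) :
    Nat.card (LabCuspPM CuHat (ofPiCHat e C μ hC hS hl hp2 hpl hζ hη hZ hN T).pmHat
      (ofPiCHat e C μ hC hS hl hp2 hpl hζ hη hZ hN T).pmHat) = l :=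
  card_labCuspPM_ofPiCHat_eq_l_of_h13ii e C μ hC hS hl hp2 hpl hζ hη hZ hN T op hx₀ huniq h65iii
    (fun x hx H hHI hHc hHf =>
      M.toTemperedCurve.commensurator_eq_map_toHat_of_galSect_cusps j hj haug CX κ hκ hGS x hx H hHI hHc hHf)
    CuHat hCu

include hj haug hκ in
/-- **The Def 2.3 (v) successor structure EXISTS at the tower of record, CONDITIONAL BY NAME on [GalSect] Thm 1.3 (ii)** (F-0103 at a
dictionary-identified L4 datum) and on the (R1c) binder `hR1c` («the inversion reverses `Z`»); further inputs F-1674, `op`, «unique cusp», L02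
`hZ`, `hN`.  `Nonempty (FlTorsorStructureConj CuHat)` for every cuspidal datum with the p432649 characterisation.
[claim: Mochizuki2012, status: disputed] (IUTchII §2 Def 2.3 (v), kurims p.69) -/
theorem nonempty_flTorsorStructureConj_ofPiCHat_of_galSect (hGS : GalSect.Thm_1_3_ii_cusps CX)
    (hR1c : ∀ w : M.PiTemp, M.toZ (e.conjX M.epsPM w) = (M.toZ w)⁻¹)
    (op : M.toThetaSetting.OncePuncturedData) (hx₀ : M.IsCusp x₀)
    (huniq : ∀ x' : M.Pt, M.IsCusp x' → x' = x₀) (h65iii : M.toTemperedCurve.IsoPreservesCuspidalDecomp M.toTemperedCurve)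
    (CuHat : CuspidalInertiaData (ofPiCHat e C μ hC hS hl hp2 hpl hζ hη hZ hN T))
    (hCu : ∀ Q' J : Subgroup (ofPiCHat e C μ hC hS hl hp2 hpl hζ hη hZ hN T).Corhat,
      CuHat.IsCuspidalInertia Q' J ↔ J ≤ Q' ∧ ∃ i : {x : M.Pt // M.IsCusp x} × M.GtpC,
        ∃ γ ∈ (ofPiCHat e C μ hC hS hl hp2 hpl hζ hη hZ hN T).pmHat,
          J = MulAut.conj γ •
            ((((MulAut.conj i.2 • (M.toTemperedCurve.inertia i.1.1).map M.inclX) ⊓ (M.GtpXu l).map M.inclX).map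
              e.toPiCHat.toMonoidHom : Subgroup (ofPiCHat e C μ hC hS hl hp2 hpl hζ hη hZ hN T).Corhat)).topologicalClosure) :
    Nonempty (FlTorsorStructureConj CuHat) :=
  nonempty_flTorsorStructureConj_ofPiCHat_of_h13ii e C μ hC hS hl hp2 hpl hζ hη hZ hN T op hx₀ huniq h65iii
    (fun x hx H hHI hHc hHf =>
      M.toTemperedCurve.commensurator_eq_map_toHat_of_galSect_cusps j hj haug CX κ hκ hGS x hx H hHI hHc hHf)
    hR1c CuHat hCu

end PlusMinusTower

end Literature.IUT.HodgeArakelov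

end
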